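import Mathlib
import Literature.NumberTheory.LFunctions.Zhang2022.Section16Lemma162RTwoDvd
import Literature.NumberTheory.LFunctions.Zhang2022.Section16Lemma162RModel
import HarnessLib

/-!
# Zhang (2022), §16 Lemma 16.2 at the repaired normaliser (`Lemma162Rq`): the VALUES of the Euler
# factors at `s = 1`, odd primes `q ∤ D` — `‖Φ_q(1) − (1 − q⁻²)/𝔭_q‖ ≤ C·α·log q/q` (`hval_odd`)

Topic `Literature/NumberTheory/LFunctions/Zhang2022` (Landau–Siegel audit tree; verdict-neutral).
Y. Zhang, *Discrete mean estimates and the Landau–Siegel zero*, arXiv:2211.02515v1 (2022)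
[Zhang2022LandauSiegel], §16 Lemma 16.2 p. 94 (tex L4646–L4653; "`𝔲₂ⱼ(1) = (6/π²)(φ(D)/(D𝔭))∏ q/(q+1)
+ O(𝓛⁻⁴)`") and its Appendix-A sketch p. 106 ("`Π₂(l) = …(1 + O(α log q))`"), **an unrefereed
manuscript under adjudication; nothing here asserts or denies its Theorems 1–2.** Lane ZHANG-L, WP16
Block D (row G-d57-1), sub-leaf `Typed.Section16B.Lemma162Rq c′`; interface of record
(zl-w09-plan `SketchHval`): `HvalOdd` — this file — and `HvalTwo` (the prime `2`, file of zl-w09-p6)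
feed `Lemma162R.lemma162Rq_of_odd_two` (`Section16Lemma162RTwoDvd`).

THEOREMS (no definitions, no facts), assembled from the landed per-prime files of zl-w09-p4:

* `model_eq_mainFactor` — the `β = 0` model value `(1 − (q^{−1})²)/locMain(χ(q),q)` of
  `Section16Lemma162RModel` IS the main factor `(1 − q⁻²)/𝔭_q` of `hasProd_frakU2Main`
  (`AppendixA.frakpFactor_eq_locMain`);
* **`hval_odd`** — for all large `D`, under (A), `j = 1, 2`, every odd prime `q ∤ D`, `q ≤ D`:
  `‖Φ_q(1) − (1 − q⁻²)/𝔭_q‖ ≤ C·α·log q/q`, from `Lemma162R.norm_Phi_one_sub_model_le`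
  (`‖Φ_q(1) − model‖ ≤ 2.5·10¹⁰·δ_q/q`, `δ_q = ‖q^{−β₁} − 1‖ + ‖q^{βⱼ} − 1‖`; (H1) from
  `half_le_norm_calM2Factor_eventually`, `χ(q) = ±1` from `apply_eq_one_or_neg_one`), the closed
  forms `Phi_model_eq_of_apply_eq_one` / `Phi_model_eq_of_apply_eq_neg_one`, and the shift sizes
  `shift_error_le` / `shift_norms_eventually` (`δ_q ≤ 6α log q`); `C = 1.5·10¹¹`.

WHAT THIS IS NOT: the prime `2` (`HvalTwo`), or anything about Theorems 1–2 / Landau–Siegel zeros.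

## References

* Y. Zhang, arXiv:2211.02515v1 (2022), §16 Lemma 16.2 p. 94; App. A pp. 105–106.
  [cite: Zhang2022LandauSiegel, §16 Lemma 16.2 p.94]
-/
noncomputable section

open Complex Real Filter Topology Finset

namespace Literature.NumberTheory.LFunctions.Zhang2022.Lemma162R

open Literature.NumberTheory.LFunctions.Zhang2022
open Literature.NumberTheory.LFunctions.Zhang2022.Skeleton
open Literature.NumberTheory.LFunctions.Zhang2022.Typed.Section16A
open Literature.NumberTheory.LFunctions.Zhang2022.Typed.Section16B
open Literature.NumberTheory.LFunctions.Zhang2022.AppendixA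

/-- The model value `(1 − (q^{−1})²)/locMain(χ(q),q)` is the main factor `(1 − q⁻²)/𝔭_q`.
[cite: Zhang2022LandauSiegel, §16 Lemma 16.2 p.94] -/
theorem model_eq_mainFactor {D : ℕ} (χ : DirichletCharacter ℂ D) (q : ℕ) :
    (1 - ((q : ℂ) ^ (-(1 : ℂ))) ^ 2) / locMain (χ (q : ZMod D)) q =
      (1 - (((q : ℂ)) ^ 2)⁻¹) / frakpFactor χ q := by
  rw [frakpFactor_eq_locMain, Complex.cpow_neg_one, inv_pow]

/-- **The values of the Euler factors of `E₂ⱼ` at `s = 1`, odd primes** (interface `HvalOdd` of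
record): for all large `D`, under (A), `j = 1, 2`, every odd prime `q ∤ D` with `q ≤ D`,
`‖Φ_q(1) − (1 − q⁻²)/𝔭_q‖ ≤ C·α·log q/q` (`Φ_q` the factor of `Lemma162R.hasProd_frakU2SeriesR` at
`s = 1`, `𝔭_q = frakpFactor χ q`; App. A p. 106 "`(1 + O(α log q))`").
[cite: Zhang2022LandauSiegel, §16 Lemma 16.2 p.94; App. A p.106] -/
theorem hval_odd (c' : ℝ) :
    ∃ C : ℝ, ForAllLarge fun D _ χ => AssumptionA D χ → ∀ j ∈ ({1, 2} : Finset ℕ),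
      ∀ q : ℕ, q.Prime → q ≠ 2 → ¬ q ∣ D → (q : ℝ) ≤ D →
        ‖(1 - (q : ℂ) ^ (-(1 : ℂ))) ^ 2 * (1 - (q : ℂ) ^ betaJ c' D j * (q : ℂ) ^ (-(1 : ℂ))) *
                (1 - χ (q : ZMod D) * (q : ℂ) ^ (-(1 : ℂ))) *
                  (1 - χ (q : ZMod D) * ((q : ℂ) ^ betaJ c' D j * (q : ℂ) ^ (-(1 : ℂ)))) ^ 2 *
              (∑' e : ℕ, varpi2loc c' χ j (q ^ e) * nuConvChi χ (q ^ e) * ((q : ℂ) ^ (-(1 : ℂ))) ^ e) -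
            (1 - (((q : ℂ)) ^ 2)⁻¹) / frakpFactor χ q‖ ≤ C * (alpha D * Real.log q / q) := by
  refine ⟨6 * 25000000000, ((half_le_norm_calM2Factor_eventually c').and
    (shift_norms_eventually c')).mono fun D _ χ hχ _ hS hA j hj q hqp hq2 hqD hqle => ?_⟩
  obtain ⟨hFD, hshD⟩ := hS
  have hq0 : (0 : ℝ) < q := by exact_mod_cast hqp.pos
  have hq3 : 3 ≤ q := by
    have h2le := hqp.two_le
    omega
  have hF := hFD j hj q hqp hq2
  have hv := apply_eq_one_or_neg_one χ hχ hqp hqD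
  have hv' : χ (q : ZMod D) = 0 ∨ χ (q : ZMod D) = 1 ∨ χ (q : ZMod D) = -1 := Or.inr hv
  have h2 : q = 2 → χ (2 : ZMod D) ≠ 1 := fun h => absurd h hq2
  obtain ⟨-, hbound⟩ := norm_Phi_one_sub_model_le c' χ j hqp hv' h2 hF
  -- the model is the main factor
  have hmodel :
      (1 - (q : ℂ) ^ (-(1 : ℂ))) ^ 2 * (1 - 1 * (q : ℂ) ^ (-(1 : ℂ))) *
            (1 - χ (q : ZMod D) * (q : ℂ) ^ (-(1 : ℂ))) *
              (1 - χ (q : ZMod D) * (1 * (q : ℂ) ^ (-(1 : ℂ)))) ^ 2 *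
          (∑' e : ℕ, (∑ i ∈ Finset.range (e + 1), χ (q : ZMod D) ^ (e - i) *
            ((1 - (if Nat.Coprime q (q ^ (e - i)) then (1 : ℂ) else 0) *
              (χ (q : ZMod D) / ((q : ℂ) - 1))) /
              (1 - 1 * (χ (q : ZMod D) / ((q : ℂ) - 1))))) * nuConvChi χ (q ^ e) *
              ((q : ℂ) ^ (-(1 : ℂ))) ^ e) =
        (1 - (((q : ℂ)) ^ 2)⁻¹) / frakpFactor χ q := by
    rw [← model_eq_mainFactor χ q]
    rcases hv with h1 | hm
    · exact Phi_model_eq_of_apply_eq_one χ hqp h1 hq3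
    · exact Phi_model_eq_of_apply_eq_neg_one χ hqp hm
  rw [← hmodel]
  -- the shift sizes
  have hδ := shift_error_le c' D j hqp.pos
  have h6 := hshD j hj
  have hlog0 : 0 ≤ Real.log q := Real.log_natCast_nonneg q
  have hα0 : 0 ≤ alpha D := by
    rw [alpha, bigP, Real.log_exp]
    have : 0 ≤ ell D := by rw [ell]; exact Real.log_natCast_nonneg D
    positivity
  set δ : ℝ := ‖(q : ℂ) ^ (-beta1 c' D) - 1‖ + ‖(q : ℂ) ^ betaJ c' D j - 1‖ with hδdef
  have hδle : δ ≤ 6 * alpha D * Real.log q :=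
    hδ.trans (by nlinarith [mul_le_mul_of_nonneg_right h6 hlog0])
  calc _ ≤ 25000000000 * δ / q := hbound
    _ ≤ 25000000000 * (6 * alpha D * Real.log q) / q := by gcongr
    _ = 6 * 25000000000 * (alpha D * Real.log q / q) := by ring

end Literature.NumberTheory.LFunctions.Zhang2022.Lemma162R

end
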